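import Literature.AlgebraicGeometry.Motives.MixedHodgeStructurePi
import Literature.AlgebraicGeometry.Motives.MixedHodgeStructureHomogeneousComponents
import Literature.AlgebraicGeometry.Motives.MixedHodgeStructureLengthFormulas
import HarnessLib

/-!
# Direct sums `⊕ⱼ Hⱼ`: length, multiplicities, semisimplicity; the simple factorization `H ≅ ⊕_α Γ_α M_α`

Sequel to `MixedHodgeStructurePi` (the finite direct sum `MixedHodgeStructure.pi H` on `Π j, W j` with its
injections `Hom.single j` and projections `Hom.proj j`), `…SemisimpleMultiplicity` (semisimple MHS are classified
by their multiplicities) and `…HomogeneousComponents` (`Tr_H(S)`). Adkins–Weintraub, *Algebra*, Ch. 7, §1: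
a semisimple module is `M ≅ ⊕_{i} M_i` with `M_i` simple ((1.3)), and collecting isomorphic summands gives the
**simple factorization `M ≅ ⊕_{α ∈ A} Γ_α M_α`** ((1.4)) with pairwise non-isomorphic simple `M_α`, unique with
`|Γ_α|` determined by `M` (Thm. 1.18, Cor. 1.19). For mixed Hodge structures (Cattani–El Zein–Griffiths–Lê,
Thm. 3.2.18, Ex. 3.2.23 (2)) this file proves:

* §1 the summands `im(single j) ⊆ ⊕ⱼ Hⱼ` are independent, span, and are `≅ H_j`.
* §2 **`λ(⊕ⱼ Hⱼ) = Σⱼ λ(Hⱼ)`**, **`[⊕ⱼ Hⱼ : S] = Σⱼ [Hⱼ : S]`**, and **`⊕ⱼ Hⱼ` is semisimple iff every `Hⱼ` is**;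
  powers `S^m = ⊕_{Fin m} S`: `[S^m : S'] = m · [S : S']`.
* §3 **the simple factorization**: for a semisimple `H`, the `S`-homogeneous component is `Tr_H(S) ≅ S^{[H : S]}`
  (`IsSemisimple.exists_iso_homogeneousComponent_pow`), and for any finite family `S_i` of pairwise non-isomorphic
  simple MHS containing (up to isomorphism) every composition factor of `H`,
  **`H ≅ ⊕_i S_i^{[H : S_i]}`** (`IsSemisimple.exists_iso_pi_pow_multiplicity`) — Adkins–Weintraub (1.4) with the
  exponents `|Γ_α| = [H : M_α]` of Thm. 1.18.

All statements proved; no definitions, no named facts, no instances.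

## References

* [AdkinsWeintraub1992] W. A. Adkins, S. H. Weintraub, Algebra, GTM 136 (1992), Ch. 7, §1, (1.3)–(1.4) (p. 401),
  Thm. 1.18 and Cor. 1.19 (pp. 402–403).
* [CattaniElZeinGriffithsLe2014] E. Cattani et al. (eds.), Hodge Theory (2014), Thm. 3.2.18, Ex. 3.2.23 (2).
* [Beachy1999RingsModules] J. A. Beachy, Introductory Lectures on Rings and Modules (1999), §2.5, Thm. 2.5.2.
-/

noncomputable section

namespace Literature.AlgebraicGeometry.Motives

namespace MixedHodgeStructure

open Module SubMixedHodgeStructure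

universe u v w

section IsoHelpers

variable {W₁ : Type*} [AddCommGroup W₁] [Module ℚ W₁] {G₁ : MixedHodgeStructure W₁}
variable {W₂ : Type*} [AddCommGroup W₂] [Module ℚ W₂] {G₂ : MixedHodgeStructure W₂}
variable {W₃ : Type*} [AddCommGroup W₃] [Module ℚ W₃] {G₃ : MixedHodgeStructure W₃}

/-- "Isomorphic" is symmetric. [cite: CattaniElZeinGriffithsLe2014, Thm. 3.2.18] -/
private theorem iso_symm (h : ∃ e : Hom G₁ G₂, Function.Bijective e.toLinearMap) :
    ∃ e : Hom G₂ G₁, Function.Bijective e.toLinearMap := by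
  obtain ⟨e, he⟩ := h
  refine ⟨e.inverse he, ?_⟩
  rw [Hom.inverse_toLinearMap]
  exact (LinearEquiv.ofBijective e.toLinearMap he).symm.bijective

/-- "Isomorphic" is transitive. [cite: CattaniElZeinGriffithsLe2014, Thm. 3.2.18] -/
private theorem iso_trans (h₁ : ∃ e : Hom G₁ G₂, Function.Bijective e.toLinearMap)
    (h₂ : ∃ e : Hom G₂ G₃, Function.Bijective e.toLinearMap) :
    ∃ e : Hom G₁ G₃, Function.Bijective e.toLinearMap := by
  obtain ⟨e₁, he₁⟩ := h₁
  obtain ⟨e₂, he₂⟩ := h₂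
  refine ⟨e₂.comp e₁, ?_⟩
  rw [Hom.comp_toLinearMap, LinearMap.coe_comp]
  exact he₂.comp he₁

end IsoHelpers

variable {ι : Type w} [Fintype ι] [DecidableEq ι]
variable {W : ι → Type v} [∀ j, AddCommGroup (W j)] [∀ j, Module ℚ (W j)]
variable {U : Type*} [AddCommGroup U] [Module ℚ U]

/-! ### §1 The summands `im(single j)` of `⊕ⱼ Hⱼ` -/

/-- The underlying subspace of `im(single j)`. [cite: CattaniElZeinGriffithsLe2014, Thm. 3.2.18] -/
theorem range_single_toSubmodule (H : ∀ j, MixedHodgeStructure (W j)) (j : ι) :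
    (Hom.single H j).range.toSubmodule = LinearMap.range (LinearMap.single ℚ W j) :=
  (Hom.single H j).range_toSubmodule

/-- **The summands `im(single j)` span `⊕ⱼ Hⱼ`.** [cite: CattaniElZeinGriffithsLe2014, Ex. 3.2.23 (2)] -/
theorem iSup_range_single_eq_top (H : ∀ j, MixedHodgeStructure (W j)) :
    (⨆ j, (Hom.single H j).range.toSubmodule) = ⊤ := by
  simp only [range_single_toSubmodule]
  exact LinearMap.iSup_range_single ℚ W

/-- **The summands `im(single j)` are independent.** [cite: CattaniElZeinGriffithsLe2014, Ex. 3.2.23 (2)] -/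
theorem iSupIndep_range_single (H : ∀ j, MixedHodgeStructure (W j)) :
    iSupIndep fun j => (Hom.single H j).range.toSubmodule := by
  intro i
  simp only [range_single_toSubmodule]
  have hle : (⨆ (j) (_ : j ≠ i), LinearMap.range (LinearMap.single ℚ W j)) ≤
      LinearMap.ker (LinearMap.proj i : (∀ j, W j) →ₗ[ℚ] W i) := by
    refine iSup_le fun j => iSup_le fun hj => ?_
    rintro _ ⟨x, rfl⟩
    rw [LinearMap.mem_ker, LinearMap.proj_apply, LinearMap.single_apply, Pi.single_eq_of_ne hj.symm]
  refine Disjoint.mono_right hle ?_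
  rw [disjoint_iff, eq_bot_iff]
  rintro _ ⟨⟨x, rfl⟩, hker⟩
  rw [SetLike.mem_coe, LinearMap.mem_ker, LinearMap.proj_apply, LinearMap.single_apply, Pi.single_eq_same] at hker
  rw [Submodule.mem_bot, hker, map_zero]

/-- `H_j ≅ im(single j)`. [cite: CattaniElZeinGriffithsLe2014, Thm. 3.2.18] -/
theorem exists_iso_range_single (H : ∀ j, MixedHodgeStructure (W j)) (j : ι) :
    ∃ e : Hom (H j) (Hom.single H j).range.toMixedHodgeStructure, Function.Bijective e.toLinearMap :=
  ⟨_, (Hom.single H j).rangeRestrict_bijective_of_injective fun a b h => by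
    have h' := congrArg (fun f : (∀ i, W i) => f j) h
    simpa only [Hom.single_toLinearMap_apply, Pi.single_eq_same] using h'⟩

/-! ### §2 Length, multiplicities and semisimplicity of `⊕ⱼ Hⱼ` -/

/-- **`λ(⊕ⱼ Hⱼ) = Σⱼ λ(Hⱼ)`.** [cite: Beachy1999RingsModules, §2.5, remark after Def. 2.5.3] [cite: CattaniElZeinGriffithsLe2014, Ex. 3.2.23 (2)] -/
theorem length_pi [∀ j, FiniteDimensional ℚ (W j)] (H : ∀ j, MixedHodgeStructure (W j)) :
    (MixedHodgeStructure.pi H).length = ∑ j, (H j).length := by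
  rw [length_eq_sum_of_iSupIndep_of_iSup_eq_top _ (iSupIndep_range_single H) (iSup_range_single_eq_top H)]
  refine Finset.sum_congr rfl fun j _ => ?_
  obtain ⟨e, he⟩ := exists_iso_range_single H j
  exact (length_eq_of_bijective e he).symm

/-- **`[⊕ⱼ Hⱼ : S] = Σⱼ [Hⱼ : S]`.** [cite: Beachy1999RingsModules, §2.5, Thm. 2.5.2] [cite: CattaniElZeinGriffithsLe2014, Ex. 3.2.23 (2)] -/
theorem multiplicity_pi [∀ j, FiniteDimensional ℚ (W j)] (H : ∀ j, MixedHodgeStructure (W j)) (S : MixedHodgeStructure U) :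
    (MixedHodgeStructure.pi H).multiplicity S = ∑ j, (H j).multiplicity S := by
  rw [multiplicity_eq_sum_of_iSupIndep_of_iSup_eq_top _ (iSupIndep_range_single H) (iSup_range_single_eq_top H) S]
  refine Finset.sum_congr rfl fun j _ => ?_
  obtain ⟨e, he⟩ := exists_iso_range_single H j
  exact (multiplicity_eq_of_bijective e he S).symm

/-- **`⊕ⱼ Hⱼ` is semisimple if every `Hⱼ` is.** [cite: AdkinsWeintraub1992, Ch. 7, §1, Cor. 1.24] [cite: CattaniElZeinGriffithsLe2014, Thm. 3.2.18] -/
theorem IsSemisimple.pi [∀ j, FiniteDimensional ℚ (W j)] {H : ∀ j, MixedHodgeStructure (W j)}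
    (h : ∀ j, (H j).IsSemisimple) : (MixedHodgeStructure.pi H).IsSemisimple := by
  refine isSemisimple_of_biSup_finset_eq_top (fun j => (Hom.single H j).range) Finset.univ (fun j _ => ?_) ?_
  · obtain ⟨e, he⟩ := exists_iso_range_single H j
    exact (h j).of_bijective e he
  · simp only [Finset.mem_univ, iSup_pos]
    exact iSup_range_single_eq_top H

/-- Conversely every summand of a semisimple `⊕ⱼ Hⱼ` is semisimple. [cite: AdkinsWeintraub1992, Ch. 7, §1, Cor. 1.24] -/
theorem IsSemisimple.of_pi {H : ∀ j, MixedHodgeStructure (W j)} (h : (MixedHodgeStructure.pi H).IsSemisimple) (j : ι) :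
    (H j).IsSemisimple := by
  obtain ⟨e, he⟩ := exists_iso_range_single H j
  exact (h.subMixedHodgeStructure _).of_bijective' e he

/-- **`⊕ⱼ Hⱼ` is semisimple iff every `Hⱼ` is.** [cite: AdkinsWeintraub1992, Ch. 7, §1, Cor. 1.24] [cite: CattaniElZeinGriffithsLe2014, Thm. 3.2.18] -/
theorem isSemisimple_pi_iff [∀ j, FiniteDimensional ℚ (W j)] (H : ∀ j, MixedHodgeStructure (W j)) :
    (MixedHodgeStructure.pi H).IsSemisimple ↔ ∀ j, (H j).IsSemisimple :=
  ⟨fun h j => h.of_pi j, IsSemisimple.pi⟩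

/-- **Powers: `[S^m : S'] = m · [S : S']`** for `S^m = ⊕_{Fin m} S`. [cite: AdkinsWeintraub1992, Ch. 7, §1, (1.4)]
[cite: Beachy1999RingsModules, §2.5, Thm. 2.5.2] -/
theorem multiplicity_pi_const {U₀ : Type v} [AddCommGroup U₀] [Module ℚ U₀] [FiniteDimensional ℚ U₀]
    (S₀ : MixedHodgeStructure U₀) (m : ℕ) (S : MixedHodgeStructure U) :
    (MixedHodgeStructure.pi fun _ : Fin m => S₀).multiplicity S = m * S₀.multiplicity S := by
  rw [multiplicity_pi, Finset.sum_const, Finset.card_univ, Fintype.card_fin, smul_eq_mul]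

/-- `λ(S^m) = m · λ(S)`. [cite: Beachy1999RingsModules, §2.5, remark after Def. 2.5.3] -/
theorem length_pi_const {U₀ : Type v} [AddCommGroup U₀] [Module ℚ U₀] [FiniteDimensional ℚ U₀]
    (S₀ : MixedHodgeStructure U₀) (m : ℕ) : (MixedHodgeStructure.pi fun _ : Fin m => S₀).length = m * S₀.length := by
  rw [length_pi, Finset.sum_const, Finset.card_univ, Fintype.card_fin, smul_eq_mul]

open scoped Classical in
/-- For a simple `S`: `[S^m : S'] = m` if `S' ≅ S`, else `0`. [cite: AdkinsWeintraub1992, Ch. 7, §1, (1.4)] -/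
theorem IsSimple.multiplicity_pi_const {U₀ : Type v} [AddCommGroup U₀] [Module ℚ U₀] [FiniteDimensional ℚ U₀]
    {S₀ : MixedHodgeStructure U₀} (hS₀ : S₀.IsSimple) (m : ℕ) (S : MixedHodgeStructure U) :
    (MixedHodgeStructure.pi fun _ : Fin m => S₀).multiplicity S =
      if (∃ e : Hom S₀ S, Function.Bijective e.toLinearMap) then m else 0 := by
  rw [MixedHodgeStructure.multiplicity_pi_const, hS₀.multiplicity_eq]
  split_ifs <;> simp

/-! ### §3 The simple factorization of a semisimple MHS -/

section Factorization

variable {V : Type u} [AddCommGroup V] [Module ℚ V] [FiniteDimensional ℚ V] {H : MixedHodgeStructure V}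
variable {U₀ : Type u} [AddCommGroup U₀] [Module ℚ U₀] [FiniteDimensional ℚ U₀] {S₀ : MixedHodgeStructure U₀}

/-- **The `S`-homogeneous component of a semisimple `H` is `Tr_H(S) ≅ S^{[H : S]}`** (it is semisimple with
`[Tr_H(S) : S] = [H : S]` and no other composition factor). [cite: AdkinsWeintraub1992, Ch. 7, §1, (1.4) and Thm. 1.18]
[cite: CattaniElZeinGriffithsLe2014, Thm. 3.2.18] -/
theorem IsSemisimple.exists_iso_homogeneousComponent_pow (hH : H.IsSemisimple) (hS₀ : S₀.IsSimple) :
    ∃ e : Hom (homogeneousComponent H S₀).toMixedHodgeStructure (MixedHodgeStructure.pi fun _ : Fin (H.multiplicity S₀) => S₀),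
      Function.Bijective e.toLinearMap := by
  classical
  refine (isSemisimple_homogeneousComponent hS₀).exists_hom_bijective_of_multiplicity_eq
    (IsSemisimple.pi fun _ => hS₀.isSemisimple) fun U _ _ S hS => ?_
  rw [hS₀.multiplicity_pi_const]
  split_ifs with he
  · obtain ⟨e, he⟩ := he
    rw [← multiplicity_congr (homogeneousComponent H S₀).toMixedHodgeStructure e he]
    exact hH.multiplicity_homogeneousComponent hS₀
  · exact multiplicity_homogeneousComponent_eq_zero_of_not_iso hS₀ hS he

variable {κ : Type} [Fintype κ] [DecidableEq κ] {Uκ : κ → Type u} [∀ i, AddCommGroup (Uκ i)] [∀ i, Module ℚ (Uκ i)]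
  [∀ i, FiniteDimensional ℚ (Uκ i)]

open scoped Classical in
/-- The multiplicities of `⊕_i S_i^{m_i}` for simple `S_i`: `[⊕_i S_i^{m_i} : S] = Σ_{i : S_i ≅ S} m_i`.
[cite: AdkinsWeintraub1992, Ch. 7, §1, (1.4) and Thm. 1.18] -/
theorem multiplicity_pi_pow (Sκ : ∀ i, MixedHodgeStructure (Uκ i)) (hS : ∀ i, (Sκ i).IsSimple)
    (m : κ → ℕ) (S : MixedHodgeStructure U) :
    (MixedHodgeStructure.pi fun q : (Σ i, Fin (m i)) => Sκ q.1).multiplicity S =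
      ∑ i, if (∃ e : Hom (Sκ i) S, Function.Bijective e.toLinearMap) then m i else 0 := by
  rw [multiplicity_pi]
  have h : ∑ q : (Σ i, Fin (m i)), (Sκ q.1).multiplicity S = ∑ i, ∑ _l : Fin (m i), (Sκ i).multiplicity S :=
    Fintype.sum_sigma (fun q : (Σ i, Fin (m i)) => (Sκ q.1).multiplicity S) |>.trans rfl
  rw [h]
  refine Finset.sum_congr rfl fun i _ => ?_
  rw [Finset.sum_const, Finset.card_univ, Fintype.card_fin, smul_eq_mul, (hS i).multiplicity_eq]
  split_ifs <;> simp

omit [DecidableEq κ] [∀ i, FiniteDimensional ℚ (Uκ i)] in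
open scoped Classical in
/-- At most one of pairwise non-isomorphic `S_i` is isomorphic to a given `S`: the sum `Σ_i [S_i ≅ S] m_i` has at
most one non-zero term. [cite: AdkinsWeintraub1992, Ch. 7, §1, Thm. 1.18 (proof)] -/
theorem sum_ite_iso_eq (Sκ : ∀ i, MixedHodgeStructure (Uκ i))
    (hne : ∀ i j, (∃ e : Hom (Sκ i) (Sκ j), Function.Bijective e.toLinearMap) → i = j)
    (m : κ → ℕ) {S : MixedHodgeStructure U} {i₀ : κ} (e : Hom (Sκ i₀) S) (he : Function.Bijective e.toLinearMap) :
    (∑ i, if (∃ e : Hom (Sκ i) S, Function.Bijective e.toLinearMap) then m i else 0) = m i₀ := by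
  rw [Finset.sum_eq_single i₀ (fun j _ hj => ?_) (fun h => absurd (Finset.mem_univ i₀) h), if_pos ⟨e, he⟩]
  rw [if_neg]
  rintro ⟨e', he'⟩
  exact hj (hne j i₀ (iso_trans ⟨e', he'⟩ (iso_symm ⟨e, he⟩)))

/-- **The simple factorization (Adkins–Weintraub (1.4), Thm. 1.18): a semisimple MHS `H` is `≅ ⊕_i S_i^{[H : S_i]}`**
for any finite family `S_i` of pairwise non-isomorphic simple MHS containing, up to isomorphism, every composition
factor of `H`. [cite: AdkinsWeintraub1992, Ch. 7, §1, (1.3)–(1.4) and Thm. 1.18] [cite: CattaniElZeinGriffithsLe2014, Thm. 3.2.18] -/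
theorem IsSemisimple.exists_iso_pi_pow_multiplicity (hH : H.IsSemisimple) (Sκ : ∀ i, MixedHodgeStructure (Uκ i))
    (hS : ∀ i, (Sκ i).IsSimple)
    (hne : ∀ i j, (∃ e : Hom (Sκ i) (Sκ j), Function.Bijective e.toLinearMap) → i = j)
    (hall : ∀ (U : Type u) [AddCommGroup U] [Module ℚ U] (S : MixedHodgeStructure U), S.IsSimple →
      0 < H.multiplicity S → ∃ i, ∃ e : Hom (Sκ i) S, Function.Bijective e.toLinearMap) :
    ∃ e : Hom H (MixedHodgeStructure.pi fun q : (Σ i, Fin (H.multiplicity (Sκ i))) => Sκ q.1), Function.Bijective e.toLinearMap := by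
  classical
  refine hH.exists_hom_bijective_of_multiplicity_eq (IsSemisimple.pi fun q => (hS q.1).isSemisimple)
    fun U _ _ S hSs => ?_
  rw [multiplicity_pi_pow Sκ hS]
  by_cases hpos : 0 < H.multiplicity S
  · obtain ⟨i₀, e, he⟩ := hall U S hSs hpos
    rw [sum_ite_iso_eq Sκ hne _ e he, multiplicity_congr H e he]
  · rw [Nat.eq_zero_of_not_pos hpos, eq_comm]
    refine Finset.sum_eq_zero fun i _ => ?_
    split_ifs with hi
    · obtain ⟨e, he⟩ := hi
      rw [multiplicity_congr H e he]
      exact Nat.eq_zero_of_not_pos hpos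
    · rfl

/-- The exponents are forced (Adkins–Weintraub Thm. 1.18: `|Γ_α| = |Λ_{ψ(α)}|`): if `H ≅ ⊕_i S_i^{m_i}` with
pairwise non-isomorphic simple `S_i`, then `m_i = [H : S_i]`. [cite: AdkinsWeintraub1992, Ch. 7, §1, Thm. 1.18 and Cor. 1.19] -/
theorem eq_multiplicity_of_iso_pi_pow (Sκ : ∀ i, MixedHodgeStructure (Uκ i)) (hS : ∀ i, (Sκ i).IsSimple)
    (hne : ∀ i j, (∃ e : Hom (Sκ i) (Sκ j), Function.Bijective e.toLinearMap) → i = j) (m : κ → ℕ)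
    (e : Hom H (MixedHodgeStructure.pi fun q : (Σ i, Fin (m i)) => Sκ q.1)) (he : Function.Bijective e.toLinearMap) (i : κ) :
    m i = H.multiplicity (Sκ i) := by
  classical
  rw [multiplicity_eq_of_bijective e he, multiplicity_pi_pow Sκ hS,
    sum_ite_iso_eq Sκ hne m (Hom.id (Sκ i)) Function.bijective_id]

end Factorization

end MixedHodgeStructure

end Literature.AlgebraicGeometry.Motives
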